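import Summits.BirchSwinnertonDyer.BirchSwinnertonDyer.Theorems.InertBadSignedBranchesInertBadAtThreeOffIstarZeroQuarticFamily
import Summits.BirchSwinnertonDyer.Rank1Residual.X12.InertBadThreeInstancesA
import Literature.NumberTheory.EllipticCurves.Rank1Residual.Typed.KolyvaginCertificate
import Literature.NumberTheory.EllipticCurves.Rank1Residual.Typed.CasselsLowerBound
import Summits.BirchSwinnertonDyer.BirchSwinnertonDyer.Theorems.ByReductionTypeAtTwoMultLowerHalfDescent
import HarnessLib

/-!
# Route `InertBadSignedBranches` (rung K8), D71 child `InertBadAtThreeOffIstarZero` (stmt-BirchSwinnertonDyer-19657,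
# HELD residual): per-pair RECORDS on the corner from certified `3`-DESCENT data — the three O10-SC@3 census
# classes with undetermined optimality/Manin datum (`484128e`, `484128cc`, `484128cd`) closed per pair WITHOUT
# Manin, and the OPEN lower half with content at the 13 beyond-census `#Ш_an = 9` pairs
# (helper `--supports` 19657; cell `bsd-cm`, seat `bsd-cm-k8i-c42` g3; theorems only, nothing asserted)

HONEST FRAMING (cell `bsd-cm`, run/shared/lean/pub/bsd-cm/): Birch–Swinnerton-Dyer is NOT proved by any
of this. The item `InertBadAtThreeOffIstarZero` is HELD (D71/D91) and OPEN at class level; nothing here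
changes that. This file is the per-pair bookkeeping that this seat's g2 `3`-descent evidence
(SEL3-EVIDENCE-k8i-c42-g2.md v3; engine HOME `bsd-cm-k8i-c42/kit/sel3/`, Schaefer–Stoll-type full
`3`-descent in the octic field `ℚ(E[3]-point)`, calibrated 18/18) called for and the referee admitted
(bsd-cm-ref g29, 08:09:30Z: a certified `3`-descent datum is the SAME DATUM CLASS as Cremona's
optimality/Manin datum in the T-KR@3 slot) — written over the tree's EXISTING consumers
(`Typed/KolyvaginCertificate.lean`, `Typed/CasselsLowerBound.lean`; cell `b2b-bsdres`) and the companion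
file `…OffIstarZeroQuarticFamily.lean` (membership of `y² = x³ + Ax` in the signed types, UNCONDITIONAL):

* §3 **GENERIC, keyed by the family.** `missingInputAt_three_of_smul_eq_quartic_of_noThreeTorsion`: for
  `W ≅ (y² = x³ + Ax)`, `ord₃ A ∈ {1, 3}`, GIVEN Gross–Zagier–Kolyvagin (`hGZK`) and the per-pair DATA
  `r_an = 1`, `#Ш_an = q` with `ord₃ q = 0`, `Ш(W)[3] = 0` ⟹ the item's four hypotheses hold at `W`
  (UNCONDITIONAL) and its conclusion `Typed.X12.MissingInputAt W 3` holds (both halves, `MissingPPartAt`)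
  — NO Manin / optimality datum, no Kolyvagin index. `lowerHalf_three_of_smul_eq_quartic_of_injective`:
  `ord₃ A = 1`, data `r_an = 1`, `#Ш_an = 9`, an exhibited `(ℤ/3)² ↪ Ш(W)` ⟹ signed type `(3, III)` and
  the pair's LOWER half `MissingLowerBoundAt W 3` with content (`ord₃ #Ш_an = 2`) — the conclusion of
  the OPEN class target `X12.O10.LowerHalfOnType 3 III` AT THE PAIR; and, modulo the eight facts of the
  type-blind upper half + a Manin datum, the item's conclusion there
  (`missingInputAt_three_of_smul_eq_quartic_of_injective`, via g0's p417833).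
* §4 **RECORDS** at `[0,0,0,5043,0]` (`484128e`, `(3, III)`), `[0,0,0,1107,0]` and `[0,0,0,1860867,0]`
  (`484128cc/cd`, `(3, III*)`): global minimality (Kraus, kernel-decided), signed type (UNCONDITIONAL),
  and the item's conclusion GIVEN `hGZK` + `r_an = 1` + `#Ш_an = 1` + `Ш[3] = 0` (kit j251946: `dim Sel₃
  = 1` on both isogenous members of each class, `bnfcertify` PASSED ⇒ GRH-free). In census currency
  (planner's / referee's word, not this file's): O10-SC@3 per pair 94/97 → 97/97.

DATA ENTER AS DISPLAYED HYPOTHESES (`hr`, `hq`, `h3` / `f`, `hf`), exactly like Cremona's `c = 1` in x1b's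
T-KR records; their certificates are kit jobs j249101 (census, `#Ш_an`), j251634 / j251818 / j251947
(13-pair descents; lower bound EXACT, `dim ≤ 3` GRH), j251946 (the three census classes, certified).
PARTITION (D-0054): CornerF inert-bad (B12 / O10) × {the 3 Manin-pending O10-SC@3 census classes} ∪ {the
13 beyond-census `(3, III)` pairs with `#Ш_an = 9`, `9.4·10⁸ ≤ N ≤ 2.6·10¹⁰`} × `p = 3` —
types-the-object-of (per-pair records; closes PAIRS only, never the class; no cell, no item; no label
moves; 19657 stays HELD).

What this is NOT: no class statement; no upper half at the 13 pairs (`Ш[3^∞] ≤ 9` would need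
`dim Sel₃ ≤ 3` GRH-free and no element of order `9`); no new typed input, no Literature statement, no
named fact, no definition.

References (locators only): [Cremona1997] allbsd / opt_man (classes 484128e, 484128cc, 484128cd);
[SchaeferStoll2004] §§5–6; [Miller2011LMS] §1, Def. 1.1; [MatarNekovar2019] Thm. 0.3, §0.11;
[SilvermanAEC2009] VII.1 Remark 1.1, VIII.8; [Kraus1989] Prop. 1–2; HOME `bsd-cm-k8i-c42/` (SEL3-EVIDENCE v3,
census/sel3_*.tsv).
-/

set_option autoImplicit false
set_option linter.dupNamespace false

noncomputable section

open scoped Classical NumberField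

open WeierstrassCurve NumberField IsDedekindDomain IsDedekindDomain.HeightOneSpectrum Field
  Rat.HeightOneSpectrum
open Literature.NumberTheory.EllipticCurves
open Literature.NumberTheory.GaloisRepresentations
open Literature.NumberTheory.EllipticCurves.ModularForms
open Literature.NumberTheory.EllipticCurves.Rank1Residual
open Literature.NumberTheory.EllipticCurves.Rank1Residual.Typed
open Literature.NumberTheory.Automorphic
open Literature.NumberTheory.DiophantineGeometry
open Literature.NumberTheory.DiophantineGeometry.TateAlgorithm
open Literature.NumberTheory.EllipticCurves.Rank1Residual.X11RankOneCertificates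
open Summit.BirchSwinnertonDyer.Rank1Residual
open Summit.BirchSwinnertonDyer.Rank1Residual.X12
open Summit.BirchSwinnertonDyer.Rank1Residual.X12.O10
open Summit.BirchSwinnertonDyer.BirchSwinnertonDyer.Theses.InertBadSignedBranches
open Summit.BirchSwinnertonDyer.BirchSwinnertonDyer.Rank1Residual.X11RankOne
open Summit.BirchSwinnertonDyer.BirchSwinnertonDyer.Theorems.InertBadOffQuarticFamily

namespace Summit.BirchSwinnertonDyer.BirchSwinnertonDyer.Theorems.InertBadOffDescentRecords

/-! ## §3 The typed halves from certified per-pair data (generic consumers keyed by the family; the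
squareness-free lower-half door is the tree's `missingLowerBoundAt_of_shaFinite_of_pow_dvd`) -/

/-- **LOWER half from an exhibited `(ℤ/p)ᵏ ↪ Ш(E/ℚ)`** (the shape a `p`-descent delivers:
`dim_{𝔽_p} Ш[p] ≥ k`) when `ord_p #Ш_an ≤ k`. [cite: Miller2011LMS, Def. 1.1 (arXiv:1010.2431 p. 3)] -/
theorem missingLowerBoundAt_of_injective (W : WeierstrassCurve ℚ) [W.IsElliptic] (p : ℕ) [Fact p.Prime]
    (hfin : W.ShaFinite) {q : ℚ} (hq : shaAn W = (q : ℂ)) {k : ℕ} (hv : padicValRat p q ≤ k)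
    (f : (Fin k → ZMod p) →+ W.sha) (hf : Function.Injective f) : MissingLowerBoundAt W p :=
  missingLowerBoundAt_of_shaFinite_of_pow_dvd W p hfin hq hv (pow_dvd_shaOrder_of_injective W p f hf)

/-- `ord₃ 9 = 2`. [folklore] -/
theorem padicValRat_three_nine : padicValRat 3 (9 : ℚ) = 2 := by
  have h : padicValNat 3 (3 ^ 2) = 2 := padicValNat.prime_pow 2
  rw [show (9 : ℚ) = ((3 ^ 2 : ℕ) : ℚ) by norm_num, padicValRat.of_nat, h]
  rfl


/-- **The item's conclusion at a pair of the corner from a `3`-DESCENT CERTIFICATE, no Manin datum.**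
For `W ≅ (y² = x³ + Ax)` with `ord₃ A ∈ {1, 3}` (signed type `(3, III)` / `(3, III*)`, UNCONDITIONAL),
GIVEN Gross–Zagier–Kolyvagin (`hGZK`: `Ш` finite in analytic rank `≤ 1`) and three per-pair DATA —
`r_an(W) = 1` (`hr`), `#Ш(W)_an = q` with `ord₃ q = 0` (`hq`, `hv`), and `Ш(W/ℚ)[3] = 0` (`h3`, the
output of a certified full `3`-descent: `dim_{𝔽₃} Sel₃(W/ℚ) = 1 = rank`) — the typed output
`MissingPPartAt W 3` (both halves), hence `Typed.X12.MissingInputAt W 3`, via the tree's level-`0`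
Kolyvagin-certificate consumer `missingPPartAt_of_shaAn_unit_of_noPTorsion`. This is the T-KR@3 slot
with the Cremona optimality/Manin datum REPLACED by a descent datum (referee bsd-cm-ref g29,
08:09:30Z: same datum class, ADMISSIBLE). PER PAIR; CONDITIONAL on the displayed data; nothing booked.
[cite: Miller2011LMS, §1 and Def. 1.1] [cite: SchaeferStoll2004, §5 and §6 (descent setup)] -/
theorem missingInputAt_three_of_smul_eq_quartic_of_noThreeTorsion
    (hGZK : rank_eq_analyticRank_of_analyticRank_le_one)
    (W : WeierstrassCurve ℚ) [W.IsElliptic] [Fact (Nat.Prime 3)]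
    (D : VariableChange ℚ) {A : ℤ} (hM : D • W = ⟨0, 0, 0, (A : ℚ), 0⟩)
    (hA : ((3 : ℤ) ∣ A ∧ ¬ (9 : ℤ) ∣ A) ∨ ((27 : ℤ) ∣ A ∧ ¬ (81 : ℤ) ∣ A))
    (hr : W.analyticRank = 1) {q : ℚ} (hq : shaAn W = (q : ℂ)) (hv : padicValRat 3 q = 0)
    (h3 : ∀ x : W.sha, (3 : ℤ) • x = 0 → x = 0) :
    (W.HasCM ∧ CMInert W 3 ∧ ¬ Good W 3 ∧ ¬ HasSignedLocalType W 3 (.Istar 0)) ∧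
      MissingPPartAt W 3 ∧ X12.MissingInputAt W 3 := by
  have hP : MissingPPartAt W 3 :=
    missingPPartAt_of_shaAn_unit_of_noPTorsion W 3 (hGZK W (by rw [hr])).2 hq hv h3
  exact ⟨offIstarZero_of_smul_eq_quartic W D hM hA, hP, fun _ ↦ hP⟩

/-- **The OPEN half at a pair of the `(3, III)` corner from a `3`-DESCENT LOWER BOUND.** For
`W ≅ (y² = x³ + Ax)` with `ord₃ A = 1`, GIVEN `hGZK` and the per-pair DATA `r_an(W) = 1` (`hr`),
`#Ш(W)_an = 9` (`hq`; certified numerics) and an exhibited `(ℤ/3)² ↪ Ш(W/ℚ)` (`f`, `hf`: two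
independent elements of `Sel₃(W/ℚ)` modulo the Mordell–Weil line — EXACT, no GRH), the pair's LOWER
half `MissingLowerBoundAt W 3` (`ord₃ #Ш_an = 2 ≤ ord₃ #Ш`) — i.e. the conclusion of the OPEN class
target `X12.O10.LowerHalfOnType 3 III` AT THIS PAIR, with content (`ord₃ #Ш_an = 2 ≠ 0`). The 13
certified instances (this seat g2, kit j249101 census + j251634/j251818 descents; all beyond Cremona's
range): `A ∈ {−5433, −6393, −5118, −7653, 8781, −9759, −14709, 10821, 11901, −14358, −15783, −16734,
−19983}`, conductors `9.4·10⁸ ≤ N = 32A² … ≤ 2.6·10¹⁰`, each with `dim Sel₃ = 3`, `Ш[3] ⊇ (ℤ/3)²`.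
What is NOT given here: the upper half at these pairs (`Ш[3^∞] ≤ 9` needs `dim Sel₃ ≤ 3`, GRH, and
no element of order `9`), so NOT `MissingInputAt`. PER PAIR; CONDITIONAL on the data; nothing booked.
[cite: Miller2011LMS, Def. 1.1 (arXiv:1010.2431 p. 3)] [cite: SchaeferStoll2004, §5 and §6 (descent setup)] -/
theorem lowerHalf_three_of_smul_eq_quartic_of_injective
    (hGZK : rank_eq_analyticRank_of_analyticRank_le_one)
    (W : WeierstrassCurve ℚ) [W.IsElliptic] [Fact (Nat.Prime 3)]
    (D : VariableChange ℚ) {A : ℤ} (hM : D • W = ⟨0, 0, 0, (A : ℚ), 0⟩)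
    (h3 : (3 : ℤ) ∣ A) (h9 : ¬ (9 : ℤ) ∣ A) (hr : W.analyticRank = 1)
    (hq : shaAn W = ((9 : ℚ) : ℂ)) (f : (Fin 2 → ZMod 3) →+ W.sha) (hf : Function.Injective f) :
    HasSignedLocalType W 3 .III ∧ MissingLowerBoundAt W 3 :=
  ⟨hasSignedLocalType_three_III_of_smul_eq_quartic W D hM h3 h9,
    missingLowerBoundAt_of_injective W 3 (hGZK W (by rw [hr])).2 hq
      (by rw [padicValRat_three_nine]; norm_num) f hf⟩

/-- … and then, modulo the eight published facts of the type-blind UPPER half at `3` and a Manin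
datum `3 ∤ c(D)` at the conductor level (uncomputed at these conductors), the item's conclusion
`Typed.X12.MissingInputAt W 3` at such a pair (g0's `missingInputAt_three_offIstarZero_of_lower`).
CONDITIONAL; nothing booked. [cite: MatarNekovar2019, Thm. 0.3 and §0.11] [cite: Miller2011LMS, §1 and Def. 1.1] -/
theorem missingInputAt_three_of_smul_eq_quartic_of_injective
    (hGZ : ∀ (N : ℕ) [NeZero N] (W : WeierstrassCurve ℚ) (K : Type) [Field K] [NumberField K],
      gross_zagier N W K)
    (hKo : ∀ (N : ℕ) [NeZero N] (W : WeierstrassCurve ℚ) (K : Type) [Field K] [NumberField K],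
      kolyvagin N W K)
    (hMN : ∀ (N : ℕ) [NeZero N] (W : WeierstrassCurve ℚ) (K : Type) [Field K] [NumberField K],
      MatarNekovar2019.thm03_padicValNat_card_sha_le_of_irreducible N W K)
    (hGZK : rank_eq_analyticRank_of_analyticRank_le_one) (hmod : hasEntireLFunction_rat)
    (hnf : exists_isNewformOf) (hFH : friedbergHoffstein_exists_heegnerField_split_twist_ne_zero)
    (hCM8 : bsdTriple_of_hasCM_of_L_one_ne_zero)
    (W : WeierstrassCurve ℚ) [W.IsElliptic] [W.IsGloballyMinimal] [Fact (Nat.Prime 3)]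
    [NeZero (W.conductorNorm ℤ)]
    (D : VariableChange ℚ) {A : ℤ} (hM : D • W = ⟨0, 0, 0, (A : ℚ), 0⟩)
    (h3 : (3 : ℤ) ∣ A) (h9 : ¬ (9 : ℤ) ∣ A) (hr : W.analyticRank = 1)
    (P : ModularParametrizationData W (W.conductorNorm ℤ)) (hc : ¬ (3 : ℤ) ∣ P.c)
    (hq : shaAn W = ((9 : ℚ) : ℂ)) (f : (Fin 2 → ZMod 3) →+ W.sha) (hf : Function.Injective f) :
    X12.MissingInputAt W 3 := by
  obtain ⟨hT, hlow⟩ := lowerHalf_three_of_smul_eq_quartic_of_injective hGZK W D hM h3 h9 hr hq f hf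
  obtain ⟨hCM, hin, hbad, -⟩ := InertBadOffLowerHalf.offIstarZero_of_hasSignedLocalType_III W hT
  exact InertBadOffLowerHalf.missingInputAt_three_offIstarZero_of_lower hGZ hKo hMN hGZK hmod hnf hFH
    hCM8 W hCM hr hin hbad P hc hlow

/-! ## §4 The three O10-SC@3 census classes whose Cremona optimality/Manin datum is undetermined
(memo N18 v1.2 §4: `484128e` of type `(3, III)`; `484128cc`, `484128cd` of type `(3, III*)`), closed PER
PAIR by the certified `3`-descent of kit job j251946 (`dim Sel₃ = 1` on every member, `bnfcertify`
PASSED ⇒ `Ш[3] = 0` GRH-free; `#Ш_an = 1`, `r_an = 1`: Cremona `allbsd` / N18) — records keyed by the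
equations `[0,0,0,5043,0]`, `[0,0,0,1107,0]`, `[0,0,0,1860867,0]` (the `2`-isogenous members
`[0,0,0,−4A,0]` close with them, `X12/CMIsogenyInvariance.lean`). -/

set_option maxRecDepth 100000 in
/-- `[0, 0, 0, 5043, 0]` (`5043 = 3·41²`, `Δ = −2⁶·3³·41⁶`, `N = 484128 = 2⁵·3²·41²`; Cremona class
`484128e`, the one `(3, III)` class of that conductor) is globally minimal (Kraus, kernel-decided).
[cite: SilvermanAEC2009, VII.1 Remark 1.1 and VIII.8] [cite: Kraus1989, Prop. 1 and Prop. 2] -/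
theorem isGloballyMinimal_of_eq_c5043 (W : WeierstrassCurve ℚ)
    (hW : W = ⟨((0 : ℤ) : ℚ), ((0 : ℤ) : ℚ), ((0 : ℤ) : ℚ), ((5043 : ℤ) : ℚ), ((0 : ℤ) : ℚ)⟩) :
    W.IsGloballyMinimal := by
  subst hW
  exact isGloballyMinimal_of_krausCriterion_bounded 0 0 0 5043 0 (by decide) (by decide)
    (by decide +kernel)

/-- **Record `(484128e, 3)`: `W = [0,0,0,5043,0]` has signed type `(3, III)` (UNCONDITIONAL) and, GIVEN
`hGZK` + the data `r_an = 1`, `#Ш_an = 1`, `Ш(W)[3] = 0` (kit j251946, certified), the item's conclusion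
`Typed.X12.MissingInputAt W 3` — no Manin/optimality datum.** PER PAIR; CONDITIONAL on the data.
[cite: Cremona1997, allbsd (class 484128e)] [cite: Miller2011LMS, §1 and Def. 1.1] -/
theorem record_three_c5043 (hGZK : rank_eq_analyticRank_of_analyticRank_le_one)
    (W : WeierstrassCurve ℚ) [W.IsElliptic] [Fact (Nat.Prime 3)]
    (hW : W = ⟨((0 : ℤ) : ℚ), ((0 : ℤ) : ℚ), ((0 : ℤ) : ℚ), ((5043 : ℤ) : ℚ), ((0 : ℤ) : ℚ)⟩)
    (hr : W.analyticRank = 1) (hq : shaAn W = ((1 : ℚ) : ℂ))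
    (h3 : ∀ x : W.sha, (3 : ℤ) • x = 0 → x = 0) :
    HasSignedLocalType W 3 .III ∧ MissingPPartAt W 3 ∧ X12.MissingInputAt W 3 := by
  have hM : (1 : VariableChange ℚ) • W = ⟨0, 0, 0, ((5043 : ℤ) : ℚ), 0⟩ := by
    rw [one_smul, hW]; ext <;> norm_num
  obtain ⟨-, hP, hI⟩ := missingInputAt_three_of_smul_eq_quartic_of_noThreeTorsion hGZK W 1 hM
    (Or.inl ⟨by norm_num, by norm_num⟩) hr hq (by simp) h3
  exact ⟨hasSignedLocalType_three_III_of_smul_eq_quartic W 1 hM (by norm_num) (by norm_num), hP, hI⟩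

set_option maxRecDepth 100000 in
/-- `[0, 0, 0, 1107, 0]` (`1107 = 3³·41`, `Δ = −2⁶·3⁹·41³`, `N = 484128`; Cremona class `484128cc` or
`484128cd`, type `(3, III*)`) is globally minimal (Kraus, kernel-decided).
[cite: SilvermanAEC2009, VII.1 Remark 1.1 and VIII.8] [cite: Kraus1989, Prop. 1 and Prop. 2] -/
theorem isGloballyMinimal_of_eq_c1107 (W : WeierstrassCurve ℚ)
    (hW : W = ⟨((0 : ℤ) : ℚ), ((0 : ℤ) : ℚ), ((0 : ℤ) : ℚ), ((1107 : ℤ) : ℚ), ((0 : ℤ) : ℚ)⟩) :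
    W.IsGloballyMinimal := by
  subst hW
  exact isGloballyMinimal_of_krausCriterion_bounded 0 0 0 1107 0 (by decide) (by decide)
    (by decide +kernel)

/-- **Record `(484128cc/cd, 3)`, first class: `W = [0,0,0,1107,0]` has signed type `(3, III*)`
(UNCONDITIONAL) and, GIVEN `hGZK` + the data `r_an = 1`, `#Ш_an = 1`, `Ш(W)[3] = 0` (kit j251946,
certified), `Typed.X12.MissingInputAt W 3` — no Manin/optimality datum.** PER PAIR; CONDITIONAL.
[cite: Cremona1997, allbsd (classes 484128cc, 484128cd)] [cite: Miller2011LMS, §1 and Def. 1.1] -/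
theorem record_three_c1107 (hGZK : rank_eq_analyticRank_of_analyticRank_le_one)
    (W : WeierstrassCurve ℚ) [W.IsElliptic] [Fact (Nat.Prime 3)]
    (hW : W = ⟨((0 : ℤ) : ℚ), ((0 : ℤ) : ℚ), ((0 : ℤ) : ℚ), ((1107 : ℤ) : ℚ), ((0 : ℤ) : ℚ)⟩)
    (hr : W.analyticRank = 1) (hq : shaAn W = ((1 : ℚ) : ℂ))
    (h3 : ∀ x : W.sha, (3 : ℤ) • x = 0 → x = 0) :
    HasSignedLocalType W 3 .IIIstar ∧ MissingPPartAt W 3 ∧ X12.MissingInputAt W 3 := by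
  have hM : (1 : VariableChange ℚ) • W = ⟨0, 0, 0, ((1107 : ℤ) : ℚ), 0⟩ := by
    rw [one_smul, hW]; ext <;> norm_num
  obtain ⟨-, hP, hI⟩ := missingInputAt_three_of_smul_eq_quartic_of_noThreeTorsion hGZK W 1 hM
    (Or.inr ⟨by norm_num, by norm_num⟩) hr hq (by simp) h3
  exact ⟨hasSignedLocalType_three_IIIstar_of_smul_eq_quartic W 1 hM (by norm_num) (by norm_num), hP, hI⟩

set_option maxRecDepth 100000 in
/-- `[0, 0, 0, 1860867, 0]` (`1860867 = 3³·41³`, `Δ = −2⁶·3⁹·41⁹`, `N = 484128`; the other of the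
classes `484128cc`/`484128cd`, type `(3, III*)`) is globally minimal (Kraus, kernel-decided).
[cite: SilvermanAEC2009, VII.1 Remark 1.1 and VIII.8] [cite: Kraus1989, Prop. 1 and Prop. 2] -/
theorem isGloballyMinimal_of_eq_c1860867 (W : WeierstrassCurve ℚ)
    (hW : W = ⟨((0 : ℤ) : ℚ), ((0 : ℤ) : ℚ), ((0 : ℤ) : ℚ), ((1860867 : ℤ) : ℚ), ((0 : ℤ) : ℚ)⟩) :
    W.IsGloballyMinimal := by
  subst hW
  exact isGloballyMinimal_of_krausCriterion_bounded 0 0 0 1860867 0 (by decide) (by decide)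
    (by decide +kernel)

/-- **Record `(484128cc/cd, 3)`, second class: `W = [0,0,0,1860867,0]` has signed type `(3, III*)`
(UNCONDITIONAL) and, GIVEN `hGZK` + the data `r_an = 1`, `#Ш_an = 1`, `Ш(W)[3] = 0` (kit j251946,
certified), `Typed.X12.MissingInputAt W 3` — no Manin/optimality datum.** PER PAIR; CONDITIONAL.
[cite: Cremona1997, allbsd (classes 484128cc, 484128cd)] [cite: Miller2011LMS, §1 and Def. 1.1] -/
theorem record_three_c1860867 (hGZK : rank_eq_analyticRank_of_analyticRank_le_one)
    (W : WeierstrassCurve ℚ) [W.IsElliptic] [Fact (Nat.Prime 3)]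
    (hW : W = ⟨((0 : ℤ) : ℚ), ((0 : ℤ) : ℚ), ((0 : ℤ) : ℚ), ((1860867 : ℤ) : ℚ), ((0 : ℤ) : ℚ)⟩)
    (hr : W.analyticRank = 1) (hq : shaAn W = ((1 : ℚ) : ℂ))
    (h3 : ∀ x : W.sha, (3 : ℤ) • x = 0 → x = 0) :
    HasSignedLocalType W 3 .IIIstar ∧ MissingPPartAt W 3 ∧ X12.MissingInputAt W 3 := by
  have hM : (1 : VariableChange ℚ) • W = ⟨0, 0, 0, ((1860867 : ℤ) : ℚ), 0⟩ := by
    rw [one_smul, hW]; ext <;> norm_num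
  obtain ⟨-, hP, hI⟩ := missingInputAt_three_of_smul_eq_quartic_of_noThreeTorsion hGZK W 1 hM
    (Or.inr ⟨by norm_num, by norm_num⟩) hr hq (by simp) h3
  exact ⟨hasSignedLocalType_three_IIIstar_of_smul_eq_quartic W 1 hM (by norm_num) (by norm_num), hP, hI⟩

end Summit.BirchSwinnertonDyer.BirchSwinnertonDyer.Theorems.InertBadOffDescentRecords

end
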